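import Literature.AnabelianGeometry.EtaleTheta.TemperedCoverings

/-!
# [EtTh] Def. 3.1 (i) / Prop. 3.2 (i): `ℤ`-coordinates of log-divisors, positive and negative parts,
# and "every Cartier log-divisor is a quotient of two EFFECTIVE Cartier log-divisors"

S. Mochizuki, *The étale theta function and its Frobenioid-theoretic manifestations*, Publ. RIMS **45**
(2009) [MochizukiEtTh2009], §3, Definition 3.1 (i) and Proposition 3.2 (i), PRIMS PDF p.70 (printed
p.296) [cite: MochizukiEtTh2009, Def 3.1 p.70].

Derived DATA of the frozen interface `LogDivisorModel` (`TemperedCoverings.lean`, v3; nothing there is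
edited or restated): Definition 3.1 (i) identifies the effective log-divisors `DIV⁺(Z^log_∞)` with the
`ℕ`-valued functions on "cusps ⊔ irreducible components of the special fibre" (`divPlusEquiv`), and
"`DIV(Z^log_∞) = DIV⁺(Z^log_∞)^gp`" (`exists_div_eq`).  This file extends the identification to the
whole group of log-divisors:

* `LogDivisorModel.mult` / `LogDivisorModel.coord` — the multiplicity of an effective log-divisor, resp.
  the `ℤ`-coordinate of an arbitrary log-divisor, at a prime log-divisor; `coord` is additive, extends
  `mult`, and is injective (`eq_one_of_coord_eq_zero`);
* `LogDivisorModel.posPart` / `negPart` — the divisor of zeroes / of poles: `D · D₋ = D₊` with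
  `D₊, D₋ ∈ DIV⁺` (`mul_negPart_eq_posPart`);
* `LogDivisorModel.cartierNum` / `cartierDen` — for a CARTIER log-divisor `D ∈ Div(Z^log_∞)` the
  canonical effective CARTIER log-divisors `D · D₋ⁿ`, `D₋ⁿ` (`n` = the exponent of Prop. 3.2 (i),
  "`n · DIV(Z^log_∞) ⊆ Div(Z^log_∞)`"), so that `D = (D · D₋ⁿ) / D₋ⁿ` inside `Div⁺(Z^log_∞)^gp`
  (`cartierNum_mem_Divplus`, `cartierDen_mem_Divplus`, `exists_Divplus_mul_eq`).

The last item is exactly what makes Definition 3.3 (iii)'s natural transformation `B₀ → Φ₀^gp`,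
"assigning to a log-meromorphic function its log-divisor of zeroes and poles" (PRIMS p.73), land in
`Φ₀^gp = (lim Div⁺(…)^{Gal})^gp`: the divisor of zeroes `D₊` of a Cartier log-divisor need not be Cartier
(at a node `xy = π_L^e` with `e > 1`), but `D₋ⁿ` and `D · D₋ⁿ` are.  Used by
`DivisorMonoidsOfGaloisCovering.lean` (the Def. 3.3 (iii) data of the coverings dominated by one
universal combinatorial covering).  Pure consequences of the typed interface; no new structure field, no
named Prop fact, no instance.  HONEST FRAMING: consequences of typed definitions; nothing here bears on
[IUTchIII] Cor. 3.12; typed ≠ proved.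
-/

namespace Literature.AnabelianGeometry.EtaleTheta

namespace LogDivisorModel

universe u

variable (Z : LogDivisorModel.{u})

/-! ## Multiplicities of effective log-divisors (Def. 3.1 (i)) -/

/-- The index set of prime log-divisors of `Z^log_∞`: "the cusps [i.e., irreducible components of the
divisor of cusps] and irreducible components of the special fiber" (Prop. 3.2 (i), p.70).
[cite: MochizukiEtTh2009, Def 3.1 p.70] -/
abbrev Idx : Type u := Z.Cusp ⊕ Z.Comp

/-- The multiplicity of the effective log-divisor `d` at the prime log-divisor `x` (additive reading of
`divPlusEquiv`, Def. 3.1 (i)). [cite: MochizukiEtTh2009, Def 3.1 p.70] -/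
def mult (d : Z.DIVplus) (x : Z.Idx) : ℕ := Multiplicative.toAdd (Z.divPlusEquiv d x)

/-- Multiplicities are additive. [cite: MochizukiEtTh2009, Def 3.1 p.70] -/
theorem mult_mul (d d' : Z.DIVplus) (x : Z.Idx) : Z.mult (d * d') x = Z.mult d x + Z.mult d' x := by
  simp only [mult, map_mul, Pi.mul_apply, toAdd_mul]

/-- The trivial divisor has multiplicity `0` everywhere. [cite: MochizukiEtTh2009, Def 3.1 p.70] -/
theorem mult_one (x : Z.Idx) : Z.mult 1 x = 0 := by
  simp only [mult, map_one, Pi.one_apply, toAdd_one]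

/-- An effective log-divisor is determined by its multiplicities. [cite: MochizukiEtTh2009, Def 3.1 p.70] -/
theorem eq_of_mult_eq {d d' : Z.DIVplus} (h : ∀ x, Z.mult d x = Z.mult d' x) : d = d' :=
  Z.divPlusEquiv.injective (funext fun x => Multiplicative.toAdd.injective (h x))

/-- The effective log-divisor with prescribed multiplicities. [cite: MochizukiEtTh2009, Def 3.1 p.70] -/
def ofMult (m : Z.Idx → ℕ) : Z.DIVplus := Z.divPlusEquiv.symm fun x => Multiplicative.ofAdd (m x)

/-- `ofMult m` has multiplicities `m`. [cite: MochizukiEtTh2009, Def 3.1 p.70] -/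
@[simp] theorem mult_ofMult (m : Z.Idx → ℕ) (x : Z.Idx) : Z.mult (Z.ofMult m) x = m x := by
  simp only [mult, ofMult, MulEquiv.apply_symm_apply, toAdd_ofAdd]

/-! ## `ℤ`-coordinates of log-divisors ("`DIV = (DIV⁺)^gp`", Def. 3.1 (i)) -/

/-- The `ℤ`-coordinate of the log-divisor `d` at the prime log-divisor `x`: writing `d · b = a` with
`a, b` effective (`exists_div_eq`), it is `mult a x - mult b x` (independent of the choice,
`coord_eq_of_mul_eq`). [cite: MochizukiEtTh2009, Def 3.1 p.70] -/
noncomputable def coord (d : Z.DIV) (x : Z.Idx) : ℤ :=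
  (Z.mult ⟨_, (Z.exists_div_eq d).choose_spec.1⟩ x : ℤ) -
    (Z.mult ⟨_, (Z.exists_div_eq d).choose_spec.2.choose_spec.1⟩ x : ℤ)

/-- Two presentations `d · b = a`, `d · b' = a'` by effective log-divisors give the same difference of
multiplicities. [cite: MochizukiEtTh2009, Def 3.1 p.70] -/
theorem mult_sub_mult_eq {d a b a' b' : Z.DIV} (ha : a ∈ Z.DIVplus) (hb : b ∈ Z.DIVplus)
    (ha' : a' ∈ Z.DIVplus) (hb' : b' ∈ Z.DIVplus) (h : d * b = a) (h' : d * b' = a') (x : Z.Idx) :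
    (Z.mult ⟨a, ha⟩ x : ℤ) - (Z.mult ⟨b, hb⟩ x : ℤ) = (Z.mult ⟨a', ha'⟩ x : ℤ) - (Z.mult ⟨b', hb'⟩ x : ℤ) := by
  have key : (⟨a, ha⟩ : Z.DIVplus) * ⟨b', hb'⟩ = ⟨a', ha'⟩ * ⟨b, hb⟩ := by
    refine Subtype.ext ?_
    change a * b' = a' * b
    rw [← h, ← h', mul_right_comm]
  have hx := congrArg (fun e : Z.DIVplus => (Z.mult e x : ℤ)) key
  simp only [mult_mul, Nat.cast_add] at hx
  linarith

/-- `coord` may be computed from ANY presentation `d · b = a` with `a, b` effective.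
[cite: MochizukiEtTh2009, Def 3.1 p.70] -/
theorem coord_eq_of_mul_eq {d a b : Z.DIV} (ha : a ∈ Z.DIVplus) (hb : b ∈ Z.DIVplus) (h : d * b = a)
    (x : Z.Idx) : Z.coord d x = (Z.mult ⟨a, ha⟩ x : ℤ) - (Z.mult ⟨b, hb⟩ x : ℤ) :=
  Z.mult_sub_mult_eq _ _ ha hb (Z.exists_div_eq d).choose_spec.2.choose_spec.2 h x

/-- On effective log-divisors `coord` is the multiplicity. [cite: MochizukiEtTh2009, Def 3.1 p.70] -/
theorem coord_of_mem {d : Z.DIV} (hd : d ∈ Z.DIVplus) (x : Z.Idx) : Z.coord d x = Z.mult ⟨d, hd⟩ x := by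
  rw [Z.coord_eq_of_mul_eq hd Z.DIVplus.one_mem (mul_one d) x]
  change (Z.mult ⟨d, hd⟩ x : ℤ) - (Z.mult 1 x : ℤ) = _
  rw [mult_one, Nat.cast_zero, sub_zero]

/-- `coord` is additive. [cite: MochizukiEtTh2009, Def 3.1 p.70] -/
theorem coord_mul (d d' : Z.DIV) (x : Z.Idx) : Z.coord (d * d') x = Z.coord d x + Z.coord d' x := by
  obtain ⟨a, ha, b, hb, h⟩ := Z.exists_div_eq d
  obtain ⟨a', ha', b', hb', h'⟩ := Z.exists_div_eq d'
  have hab : d * d' * (b * b') = a * a' := by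
    rw [← h, ← h']
    exact mul_mul_mul_comm d d' b b'
  rw [Z.coord_eq_of_mul_eq ha hb h, Z.coord_eq_of_mul_eq ha' hb' h',
    Z.coord_eq_of_mul_eq (Z.DIVplus.mul_mem ha ha') (Z.DIVplus.mul_mem hb hb') hab]
  have e₁ : (⟨a * a', Z.DIVplus.mul_mem ha ha'⟩ : Z.DIVplus) = ⟨a, ha⟩ * ⟨a', ha'⟩ := rfl
  have e₂ : (⟨b * b', Z.DIVplus.mul_mem hb hb'⟩ : Z.DIVplus) = ⟨b, hb⟩ * ⟨b', hb'⟩ := rfl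
  rw [e₁, e₂, mult_mul, mult_mul]
  push_cast
  ring

/-- `coord 1 = 0`. [cite: MochizukiEtTh2009, Def 3.1 p.70] -/
theorem coord_one (x : Z.Idx) : Z.coord 1 x = 0 := by
  rw [Z.coord_of_mem Z.DIVplus.one_mem]
  change ((Z.mult 1 x : ℕ) : ℤ) = 0
  rw [mult_one, Nat.cast_zero]

/-- `coord d⁻¹ = - coord d`. [cite: MochizukiEtTh2009, Def 3.1 p.70] -/
theorem coord_inv (d : Z.DIV) (x : Z.Idx) : Z.coord d⁻¹ x = -Z.coord d x := by
  have h := Z.coord_mul d d⁻¹ x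
  rw [mul_inv_cancel, coord_one] at h
  linarith

/-- A log-divisor all of whose coordinates vanish is trivial ("`DIV⁺` is sharp and generates `DIV`").
[cite: MochizukiEtTh2009, Def 3.1 p.70] -/
theorem eq_one_of_coord_eq_zero {d : Z.DIV} (h : ∀ x, Z.coord d x = 0) : d = 1 := by
  obtain ⟨a, ha, b, hb, hab⟩ := Z.exists_div_eq d
  have heq : (⟨a, ha⟩ : Z.DIVplus) = ⟨b, hb⟩ := by
    refine Z.eq_of_mult_eq fun x => ?_
    have hx := h x
    rw [Z.coord_eq_of_mul_eq ha hb hab x] at hx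
    exact_mod_cast (sub_eq_zero.mp hx)
  have hab' : a = b := congrArg Subtype.val heq
  rw [hab'] at hab
  simpa using hab

/-- Log-divisors with the same coordinates are equal. [cite: MochizukiEtTh2009, Def 3.1 p.70] -/
theorem eq_of_coord_eq {d d' : Z.DIV} (h : ∀ x, Z.coord d x = Z.coord d' x) : d = d' := by
  have h1 : d * d'⁻¹ = 1 := Z.eq_one_of_coord_eq_zero fun x => by
    rw [coord_mul, coord_inv, h x, add_neg_cancel]
  rwa [mul_inv_eq_one] at h1

/-! ## Divisor of zeroes and divisor of poles -/

/-- The divisor of zeroes `D₊` of a log-divisor (coordinatewise positive part).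
[cite: MochizukiEtTh2009, Def 3.1 p.70] -/
noncomputable def posPart (d : Z.DIV) : Z.DIVplus := Z.ofMult fun x => (Z.coord d x).toNat

/-- The divisor of poles `D₋` of a log-divisor (coordinatewise negative part).
[cite: MochizukiEtTh2009, Def 3.1 p.70] -/
noncomputable def negPart (d : Z.DIV) : Z.DIVplus := Z.ofMult fun x => (-Z.coord d x).toNat

/-- `D · D₋ = D₊`. [cite: MochizukiEtTh2009, Def 3.1 p.70] -/
theorem mul_negPart_eq_posPart (d : Z.DIV) : d * (Z.negPart d : Z.DIV) = Z.posPart d := by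
  refine Z.eq_of_coord_eq fun x => ?_
  rw [coord_mul, Z.coord_of_mem (Z.negPart d).2, Z.coord_of_mem (Z.posPart d).2]
  change Z.coord d x + (Z.mult (Z.negPart d) x : ℤ) = (Z.mult (Z.posPart d) x : ℤ)
  simp only [negPart, posPart, mult_ofMult]
  have := Int.toNat_sub_toNat_neg (Z.coord d x)
  linarith

/-- `D = D₊ / D₋`. [cite: MochizukiEtTh2009, Def 3.1 p.70] -/
theorem eq_posPart_div_negPart (d : Z.DIV) : d = (Z.posPart d : Z.DIV) / (Z.negPart d : Z.DIV) := by
  rw [eq_div_iff_mul_eq', mul_negPart_eq_posPart]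

/-! ## Prop. 3.2 (i): every Cartier log-divisor is a quotient of effective CARTIER log-divisors -/

/-- The exponent `n` of Proposition 3.2 (i): "`n · DIV(Z^log_∞) ⊆ Div(Z^log_∞)`" (a choice of the
`n` whose existence the interface field `exists_pow_mem_Div` records). [cite: MochizukiEtTh2009, Prop 3.2 p.70] -/
noncomputable def cartierExp : ℕ+ := Z.exists_pow_mem_Div.choose

/-- `dⁿ` is Cartier for every log-divisor `d`. [cite: MochizukiEtTh2009, Prop 3.2 p.70] -/
theorem pow_cartierExp_mem_Div (d : Z.DIV) : d ^ (Z.cartierExp : ℕ) ∈ Z.Div :=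
  Z.exists_pow_mem_Div.choose_spec d

/-- The canonical effective Cartier DENOMINATOR `D₋ⁿ` of a log-divisor. [cite: MochizukiEtTh2009, Prop 3.2 p.70] -/
noncomputable def cartierDen (d : Z.DIV) : Z.DIV := (Z.negPart d : Z.DIV) ^ (Z.cartierExp : ℕ)

/-- The canonical NUMERATOR `D · D₋ⁿ` of a log-divisor. [cite: MochizukiEtTh2009, Prop 3.2 p.70] -/
noncomputable def cartierNum (d : Z.DIV) : Z.DIV := d * Z.cartierDen d

/-- `D · (denominator) = numerator` (by definition). [cite: MochizukiEtTh2009, Prop 3.2 p.70] -/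
theorem mul_cartierDen (d : Z.DIV) : d * Z.cartierDen d = Z.cartierNum d := rfl

/-- The denominator `D₋ⁿ` is an effective Cartier log-divisor. [cite: MochizukiEtTh2009, Prop 3.2 p.70] -/
theorem cartierDen_mem_Divplus (d : Z.DIV) : Z.cartierDen d ∈ Z.Divplus :=
  ⟨Z.pow_cartierExp_mem_Div _, Z.DIVplus.pow_mem (Z.negPart d).2 _⟩

/-- The numerator `D · D₋ⁿ = D₊ · D₋ⁿ⁻¹` is effective. [cite: MochizukiEtTh2009, Prop 3.2 p.70] -/
theorem cartierNum_mem_DIVplus (d : Z.DIV) : Z.cartierNum d ∈ Z.DIVplus := by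
  have hn : (Z.cartierExp : ℕ) = (Z.cartierExp : ℕ).pred + 1 :=
    (Nat.succ_pred_eq_of_pos Z.cartierExp.pos).symm
  rw [cartierNum, cartierDen, hn, pow_succ', ← mul_assoc, mul_negPart_eq_posPart]
  exact Z.DIVplus.mul_mem (Z.posPart d).2 (Z.DIVplus.pow_mem (Z.negPart d).2 _)

/-- For a CARTIER log-divisor the numerator `D · D₋ⁿ` is an effective Cartier log-divisor.
[cite: MochizukiEtTh2009, Prop 3.2 p.70] -/
theorem cartierNum_mem_Divplus {d : Z.DIV} (hd : d ∈ Z.Div) : Z.cartierNum d ∈ Z.Divplus :=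
  ⟨Z.Div.mul_mem hd (Z.cartierDen_mem_Divplus d).1, Z.cartierNum_mem_DIVplus d⟩

/-- **Prop. 3.2 (i), consequence**: every Cartier log-divisor `D ∈ Div(Z^log_∞)` is a quotient `A / B` of
two EFFECTIVE CARTIER log-divisors `A, B ∈ Div⁺(Z^log_∞)` (take `B = D₋ⁿ`, `A = D · D₋ⁿ`), i.e.
`Div(Z^log_∞) ⊆ Div⁺(Z^log_∞)^gp` — what makes "the log-divisor of zeroes and poles" of a log-meromorphic
function an element of `Φ₀^gp` (Def. 3.3 (iii), p.73). [cite: MochizukiEtTh2009, Prop 3.2 p.70] -/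
theorem exists_Divplus_mul_eq {d : Z.DIV} (hd : d ∈ Z.Div) :
    ∃ A ∈ Z.Divplus, ∃ B ∈ Z.Divplus, d * B = A :=
  ⟨_, Z.cartierNum_mem_Divplus hd, _, Z.cartierDen_mem_Divplus d, rfl⟩

/-! ## Non-cuspidal and cuspidal parts of an effective log-divisor -/

/-- The part of an effective log-divisor supported on the irreducible components of the special fibre
(multiplicities at the cusps set to `0`). [cite: MochizukiEtTh2009, Def 3.1 p.70] -/
def compPart (d : Z.DIVplus) : Z.DIVplus :=
  Z.ofMult fun x => Sum.elim (fun _ => 0) (fun c => Z.mult d (Sum.inr c)) x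

/-- The part of an effective log-divisor supported on the cusps (multiplicities at the irreducible
components of the special fibre set to `0`). [cite: MochizukiEtTh2009, Def 3.1 p.70] -/
def cuspPart (d : Z.DIVplus) : Z.DIVplus :=
  Z.ofMult fun x => Sum.elim (fun c => Z.mult d (Sum.inl c)) (fun _ => 0) x

/-- `d = (non-cuspidal part) · (cuspidal part)`. [cite: MochizukiEtTh2009, Def 3.1 p.70] -/
theorem compPart_mul_cuspPart (d : Z.DIVplus) : Z.compPart d * Z.cuspPart d = d := by
  refine Z.eq_of_mult_eq fun x => ?_
  rw [mult_mul]
  rcases x with c | c <;> simp [compPart, cuspPart]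

/-- The non-cuspidal part is a non-cuspidal log-divisor ("support in the special fiber", via
`divPlusEquiv_nonCuspidal`). [cite: MochizukiEtTh2009, Def 3.1 p.70] -/
theorem compPart_mem_nonCuspidal (d : Z.DIVplus) : (Z.compPart d : Z.DIV) ∈ Z.nonCuspidal := by
  rw [Z.divPlusEquiv_nonCuspidal]
  intro c
  have h : Z.mult (Z.compPart d) (Sum.inl c) = 0 := by simp [compPart]
  exact Multiplicative.toAdd.injective (by rw [toAdd_one]; exact h)

/-- An effective log-divisor with no multiplicity at the cusps equals its non-cuspidal part.
[cite: MochizukiEtTh2009, Def 3.1 p.70] -/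
theorem compPart_eq_self_of {d : Z.DIVplus} (h : ∀ c : Z.Cusp, Z.mult d (Sum.inl c) = 0) :
    Z.compPart d = d := by
  refine Z.eq_of_mult_eq fun x => ?_
  rcases x with c | c <;> simp [compPart, h]

/-- An effective log-divisor with no multiplicity along the special fibre equals its cuspidal part.
[cite: MochizukiEtTh2009, Def 3.1 p.70] -/
theorem cuspPart_eq_self_of {d : Z.DIVplus} (h : ∀ c : Z.Comp, Z.mult d (Sum.inr c) = 0) :
    Z.cuspPart d = d := by
  refine Z.eq_of_mult_eq fun x => ?_
  rcases x with c | c <;> simp [cuspPart, h]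

end LogDivisorModel

end Literature.AnabelianGeometry.EtaleTheta
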